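import Summits.NavierStokesRegularity.NavierStokesRegularity.Theorems.ExtremiserTransienceTwoThirdsDefs
import HarnessLib

/-!
# Route `ExtremiserTransience`, crux `NearExtremalTransiencePerFlow` (stmt-NavierStokesRegularity-26567),
# LINE g10-1 «two_thirds» (ns-idea-10), stub S1a′ — BRICK 2, lemma P4c: SUMS OVER A SEPARATED PACKING (one active cell at each point)

`--supports stmt-NavierStokesRegularity-26567` (helper; prover seat ns-net-p2 g13).  The cells of one translate of the packing of S1a′ have centres
at mutual distance `≥ 4ρ⁸` and every cell quantity (piece, weight, offsets) is supported in `B(c, 3ρ⁸/2)`; hence AT MOST ONE cell is active at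
any point.  For a family `g c` supported in `B(c, r)` with centres `2r`-separated:

* `packing_owner` — at `x`, either a unique owner `c₀ ∈ F` carries the whole sum, or every term vanishes;
* `norm_sum_le_of_separated` — `‖Σ_c g c x‖ ≤ M` as soon as every `‖g c x‖ ≤ M` (`M ≥ 0`);
* `norm_sq_sum_eq_of_separated` — `‖Σ_c g c x‖² = Σ_c ‖g c x‖²`;
* `sum_mem_Icc_of_separated` — a real family with values in `[0,1]` sums into `[0,1]`.
These make the REMAINDER piece `w − Σ_c φ_c` inherit the per-cell sizes without any dependence on the number of cells.
HONEST FRAMING: finite-sum bookkeeping; nothing about Navier–Stokes is proved; no summit is proved by a line. [folklore]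
-/

noncomputable section

open scoped Topology InnerProductSpace RealInnerProductSpace ENNReal NNReal ContDiff
open MeasureTheory Filter Set Metric
open Literature.Analysis.FluidPDE
open Summit.NavierStokesRegularity.NavierStokesRegularity.Theorems.DepletionLadder.KStar.HalfSpace

namespace Summit.NavierStokesRegularity.NavierStokesRegularity.Theorems.NearExtremalTransiencePerFlow.TwoThirds

-- the summit's namespace repeats the problem name by convention (D-0017)
set_option linter.dupNamespace false

section Packing

variable {X : Type*} [NormedAddCommGroup X] {F : Finset E3} {r : ℝ} {g : E3 → E3 → X}

/-- In a `2r`-separated family of centres, a point lies in at most one ball `B(c, r)`. [folklore] -/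
theorem packing_unique (hsep : ∀ c ∈ F, ∀ c' ∈ F, c ≠ c' → 2 * r ≤ dist c c') {x c₀ : E3} (hc₀ : c₀ ∈ F)
    (hx : x ∈ ball c₀ r) {c : E3} (hc : c ∈ F) (hne : c ≠ c₀) : x ∉ ball c r := by
  intro hxc
  have h := hsep c hc c₀ hc₀ hne
  rw [mem_ball] at hx hxc
  have htri : dist c c₀ ≤ dist x c + dist x c₀ := by
    calc dist c c₀ ≤ dist c x + dist x c₀ := dist_triangle c x c₀
      _ = dist x c + dist x c₀ := by rw [dist_comm c x]
  linarith

/-- **One active cell**: either some `c₀ ∈ F` with `x ∈ B(c₀,r)` carries the whole sum and every other term vanishes, or all terms vanish. [folklore] -/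
theorem packing_owner (hsep : ∀ c ∈ F, ∀ c' ∈ F, c ≠ c' → 2 * r ≤ dist c c') (hg0 : ∀ c ∈ F, ∀ x, x ∉ ball c r → g c x = 0)
    (x : E3) :
    (∃ c₀ ∈ F, x ∈ ball c₀ r ∧ (∀ c ∈ F, c ≠ c₀ → g c x = 0) ∧ ∑ c ∈ F, g c x = g c₀ x) ∨
      ((∀ c ∈ F, g c x = 0) ∧ ∑ c ∈ F, g c x = 0) := by
  by_cases h : ∃ c₀ ∈ F, x ∈ ball c₀ r
  · obtain ⟨c₀, hc₀, hx⟩ := h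
    have hoth : ∀ c ∈ F, c ≠ c₀ → g c x = 0 := fun c hc hne => hg0 c hc x (packing_unique hsep hc₀ hx hc hne)
    exact Or.inl ⟨c₀, hc₀, hx, hoth, Finset.sum_eq_single_of_mem c₀ hc₀ fun c hc hne => hoth c hc hne⟩
  · push Not at h
    have hall : ∀ c ∈ F, g c x = 0 := fun c hc => hg0 c hc x (h c hc)
    exact Or.inr ⟨hall, Finset.sum_eq_zero hall⟩

/-- **Sup bound survives the sum**: `‖Σ_c g c x‖ ≤ M` if every `‖g c x‖ ≤ M` (`M ≥ 0`). [folklore] -/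
theorem norm_sum_le_of_separated (hsep : ∀ c ∈ F, ∀ c' ∈ F, c ≠ c' → 2 * r ≤ dist c c')
    (hg0 : ∀ c ∈ F, ∀ x, x ∉ ball c r → g c x = 0) {M : ℝ} (hM : 0 ≤ M) (x : E3) (hle : ∀ c ∈ F, ‖g c x‖ ≤ M) :
    ‖∑ c ∈ F, g c x‖ ≤ M := by
  rcases packing_owner hsep hg0 x with ⟨c₀, hc₀, -, -, hsum⟩ | ⟨-, hsum⟩
  · rw [hsum]; exact hle c₀ hc₀
  · rw [hsum, norm_zero]; exact hM

/-- **No cross terms**: `‖Σ_c g c x‖² = Σ_c ‖g c x‖²`. [folklore] -/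
theorem norm_sq_sum_eq_of_separated (hsep : ∀ c ∈ F, ∀ c' ∈ F, c ≠ c' → 2 * r ≤ dist c c')
    (hg0 : ∀ c ∈ F, ∀ x, x ∉ ball c r → g c x = 0) (x : E3) :
    ‖∑ c ∈ F, g c x‖ ^ 2 = ∑ c ∈ F, ‖g c x‖ ^ 2 := by
  rcases packing_owner hsep hg0 x with ⟨c₀, hc₀, -, hoth, hsum⟩ | ⟨hall, hsum⟩
  · rw [hsum, Finset.sum_eq_single_of_mem c₀ hc₀ fun c hc hne => by rw [hoth c hc hne, norm_zero, zero_pow two_ne_zero]]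
  · rw [hsum, norm_zero, zero_pow two_ne_zero, Finset.sum_eq_zero fun c hc => by rw [hall c hc, norm_zero, zero_pow two_ne_zero]]

/-- The sum vanishes at a point outside every ball. [folklore] -/
theorem sum_eq_zero_of_forall_notMem (hg0 : ∀ c ∈ F, ∀ x, x ∉ ball c r → g c x = 0) {x : E3} (hx : ∀ c ∈ F, x ∉ ball c r) :
    ∑ c ∈ F, g c x = 0 :=
  Finset.sum_eq_zero fun c hc => hg0 c hc x (hx c hc)

/-- **Weights**: a `[0,1]`-valued family supported in the separated balls sums into `[0,1]`. [folklore] -/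
theorem sum_mem_Icc_of_separated {χ : E3 → E3 → ℝ} (hsep : ∀ c ∈ F, ∀ c' ∈ F, c ≠ c' → 2 * r ≤ dist c c')
    (hχ0 : ∀ c ∈ F, ∀ x, x ∉ ball c r → χ c x = 0) (hχ01 : ∀ c ∈ F, ∀ x, 0 ≤ χ c x ∧ χ c x ≤ 1) (x : E3) :
    0 ≤ ∑ c ∈ F, χ c x ∧ ∑ c ∈ F, χ c x ≤ 1 := by
  rcases packing_owner (g := χ) hsep hχ0 x with ⟨c₀, hc₀, -, -, hsum⟩ | ⟨-, hsum⟩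
  · rw [hsum]; exact hχ01 c₀ hc₀ x
  · rw [hsum]; exact ⟨le_refl _, zero_le_one⟩

/-- If the owner's term equals a given value, so does the sum (used with `χ c₀ x = 1` on the owner's cell). [folklore] -/
theorem sum_eq_of_owner {χ : E3 → E3 → ℝ} (hsep : ∀ c ∈ F, ∀ c' ∈ F, c ≠ c' → 2 * r ≤ dist c c')
    (hχ0 : ∀ c ∈ F, ∀ x, x ∉ ball c r → χ c x = 0) {x c₀ : E3} (hc₀ : c₀ ∈ F) (hx : x ∈ ball c₀ r) :
    ∑ c ∈ F, χ c x = χ c₀ x :=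
  Finset.sum_eq_single_of_mem c₀ hc₀ fun c hc hne => hχ0 c hc x (packing_unique hsep hc₀ hx hc hne)

end Packing

section Calculus

variable {F : Finset E3} {f : E3 → E3 → E3}

/-- Curl of a finite sum of differentiable fields. [folklore] -/
theorem curl_finset_sum' {x : E3} (h : ∀ c ∈ F, DifferentiableAt ℝ (f c) x) :
    curl (fun y => ∑ c ∈ F, f c y) x = ∑ c ∈ F, curl (f c) x := by
  rw [curl_eq_curlCLM, fderiv_fun_sum h, map_sum]
  rfl

/-- A finite sum of divergence-free differentiable fields is divergence free. [folklore] -/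
theorem isDivFree_finset_sum (hf : ∀ c ∈ F, Differentiable ℝ (f c)) (hdiv : ∀ c ∈ F, VectorCalculus.IsDivFree (f c)) :
    VectorCalculus.IsDivFree fun y => ∑ c ∈ F, f c y := by
  intro x
  unfold VectorCalculus.divergence
  rw [fderiv_fun_sum fun c hc => hf c hc x, ContinuousLinearMap.toLinearMap_sum, map_sum]
  exact Finset.sum_eq_zero fun c hc => hdiv c hc x

/-- A finite sum of smooth fields is smooth. [folklore] -/
theorem contDiff_finset_sum (hf : ∀ c ∈ F, ContDiff ℝ (⊤ : ℕ∞) (f c)) : ContDiff ℝ (⊤ : ℕ∞) fun y => ∑ c ∈ F, f c y :=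
  ContDiff.sum fun c hc => hf c hc

/-- A finite sum of fields supported in balls `B(c, r)` is compactly supported. [folklore] -/
theorem hasCompactSupport_finset_sum {r : ℝ} (h0 : ∀ c ∈ F, ∀ x, x ∉ ball c r → f c x = 0) :
    HasCompactSupport fun y => ∑ c ∈ F, f c y := by
  refine HasCompactSupport.intro (K := ⋃ c ∈ F, closedBall c r) (F.isCompact_biUnion fun c _ => isCompact_closedBall c r) fun x hx => ?_
  refine Finset.sum_eq_zero fun c hc => h0 c hc x fun hb => hx ?_
  exact Set.mem_biUnion hc (ball_subset_closedBall hb)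

end Calculus

end Summit.NavierStokesRegularity.NavierStokesRegularity.Theorems.NearExtremalTransiencePerFlow.TwoThirds

end
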